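import Literature.Computability.AlgebraicComplexity.HamiltonianCycleVNP
import Literature.Computability.AlgebraicComplexity.ArithCircuitProofs
import Summits.ValiantsHypothesis.ValiantsHypothesis.Theorems.AnyonJetsResummation
import HarnessLib

/-!
# Route `AnyonJets`, crux `UniformJetUpperBound` (stmt-ValiantsHypothesis-16739) — helper file 1a:
# Boolean points of the `VNP` witness for the inversion pencil

Point evaluations for the witness of helper file 1b (`AnyonJetsUniformJetUpperBoundWitness.lean`,
whose module doc describes the construction): `boolSum` over the block `Fin (n·n)` as a sum over
Boolean `n × n` matrices `E` (`boolSum_eq_sum_matrices`), the values at `E` of the position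
variables, of BCS's recogniser factors `α(Z)`, `β(Z)` (`aeval_point_alpha/beta`), and — at a
permutation matrix `P_σ` — of the INVERSION GADGET `∑_{j<i} Z_{(a,i)} Z_{(b,j)} = [σ b < σ a]`
(`aeval_point_indicator`), of the coupling product
`∏_{a<b} (1 + (q-1)·[σ b < σ a]) = q^{inv σ}` (`aeval_point_gadget`) and of the cover product
`∏_t X_{σ t, t}` (`aeval_point_cover`). Pattern of `FermionicJetJetsInVNP.lean` (free variables
generalised to any type `τ`). HONEST FRAMING: bookkeeping for a dormant route; nothing here bears
on `VP ≠ VNP`.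

References: P. Bürgisser, M. Clausen, M. A. Shokrollahi, *Algebraic Complexity Theory*, Springer
1997, Prop. (21.15) (the recogniser); P. Bürgisser, *Completeness and Reduction in Algebraic
Complexity Theory*, Springer 2000, Prop. 2.20.
-/

noncomputable section

-- single-conjunct layout: Sub = Summit, duplicated namespace component intended
set_option linter.dupNamespace false

namespace Summit.ValiantsHypothesis.ValiantsHypothesis.Theorems.AnyonJets.UniformJet

open Literature.Computability.AlgebraicComplexity MvPolynomial Equiv Finset

universe u v

/-! ### Boolean points -/

section Points

variable (K : Type u) [CommRing K] (τ : Type v) (n : ℕ)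

/-- `boolSum` over the Boolean block `Fin (n·n)` as a sum over Boolean `n × n` matrices `E`, the
position variable `q` being set to `[E (finProdFinEquiv⁻¹ q)]`. [folklore] -/
theorem boolSum_eq_sum_matrices (g : MvPolynomial (τ ⊕ Fin (n * n)) K) :
    boolSum g = ∑ E : Fin n × Fin n → Bool,
      aeval (Sum.elim X fun q => if E (finProdFinEquiv.symm q) then
        (1 : MvPolynomial τ K) else 0) g := by
  unfold boolSum
  refine Fintype.sum_equiv (Equiv.arrowCongr finProdFinEquiv.symm (Equiv.refl Bool)) _ _
    fun e => ?_
  congr 2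
  funext v
  rcases v with q | j
  · rfl
  · simp only [Sum.elim_inr, Equiv.arrowCongr_apply, Function.comp_apply, Equiv.coe_refl, id_eq,
      Equiv.symm_symm, Equiv.apply_symm_apply]

variable {K τ n}

/-- At the point of `E`, the position variable of `p` is `[E p]`. [folklore] -/
theorem aeval_point_X_inr (E : Fin n × Fin n → Bool) (p : Fin n × Fin n) :
    aeval (Sum.elim X fun q => if E (finProdFinEquiv.symm q) then
        (1 : MvPolynomial τ K) else 0)
      (X (Sum.inr (finProdFinEquiv p)) : MvPolynomial (τ ⊕ Fin (n * n)) K) =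
      if E p then 1 else 0 := by
  simp only [aeval_X, Sum.elim_inr, Equiv.symm_apply_apply]

/-- At the point of `E`, the free variables stay. [folklore] -/
theorem aeval_point_X_inl (E : Fin n × Fin n → Bool) (q : τ) :
    aeval (Sum.elim X fun q => if E (finProdFinEquiv.symm q) then
        (1 : MvPolynomial τ K) else 0)
      (X (Sum.inl q) : MvPolynomial (τ ⊕ Fin (n * n)) K) = X q := by
  simp only [aeval_X, Sum.elim_inl]

/-- A `K`-algebra map on the four-fold product `a b (s v)` (the shape of the witness). [folklore] -/
theorem map_mul₄ {A B : Type*} [CommSemiring A] [CommSemiring B] [Algebra K A] [Algebra K B]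
    (f : A →ₐ[K] B) (a b s v : A) : f (a * b * (s * v)) = f a * f b * (f s * f v) := by
  simp only [map_mul]

/-- At the point of `E`, BCS's `α(Z)` is `∏ (1 - [E p][E q])` over conflicting pairs. [folklore] -/
theorem aeval_point_alpha (E : Fin n × Fin n → Bool) :
    aeval (Sum.elim X fun q => if E (finProdFinEquiv.symm q) then
        (1 : MvPolynomial τ K) else 0)
      (∏ pq ∈ conflictPairs n, (1 - X (Sum.inr (finProdFinEquiv pq.1)) *
          X (Sum.inr (finProdFinEquiv pq.2))) : MvPolynomial (τ ⊕ Fin (n * n)) K) =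
      ∏ pq ∈ conflictPairs n, (1 - (if E pq.1 then (1 : MvPolynomial τ K) else 0) *
          (if E pq.2 then (1 : MvPolynomial τ K) else 0)) := by
  simp only [map_prod, map_sub, map_one, map_mul, aeval_point_X_inr]

/-- At the point of `E`, BCS's `β(Z)` is `∏_t ∑_i [E (t, i)]`. [folklore] -/
theorem aeval_point_beta (E : Fin n × Fin n → Bool) :
    aeval (Sum.elim X fun q => if E (finProdFinEquiv.symm q) then
        (1 : MvPolynomial τ K) else 0)
      (∏ t : Fin n, ∑ i : Fin n, X (Sum.inr (finProdFinEquiv (t, i))) :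
        MvPolynomial (τ ⊕ Fin (n * n)) K) =
      ∏ t, ∑ i, (if E (t, i) then (1 : MvPolynomial τ K) else 0) := by
  simp only [map_prod, map_sum, aeval_point_X_inr]

/-- **The inversion gadget at a permutation matrix.** At the point of `P_σ`,
`∑_{(i,j) : j < i} Z_{(a,i)} Z_{(b,j)} = [σ b < σ a]`. [folklore] -/
theorem aeval_point_indicator (σ : Perm (Fin n)) (a b : Fin n) :
    aeval (Sum.elim X fun q => if permGraph σ (finProdFinEquiv.symm q) then
        (1 : MvPolynomial τ K) else 0)
      (∑ ij ∈ Finset.univ.filter (fun ij : Fin n × Fin n => ij.2 < ij.1),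
        X (Sum.inr (finProdFinEquiv (a, ij.1))) * X (Sum.inr (finProdFinEquiv (b, ij.2))) :
        MvPolynomial (τ ⊕ Fin (n * n)) K) =
      if σ b < σ a then 1 else 0 := by
  simp only [map_sum, map_mul, aeval_point_X_inr]
  have hterm : ∀ ij : Fin n × Fin n,
      (if permGraph σ (a, ij.1) then (1 : MvPolynomial τ K) else 0) *
        (if permGraph σ (b, ij.2) then (1 : MvPolynomial τ K) else 0) =
      if (σ a, σ b) = ij then 1 else 0 := by
    rintro ⟨i, j⟩
    simp only [permGraph, decide_eq_true_eq, Prod.mk.injEq]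
    by_cases hi : σ a = i <;> by_cases hj : σ b = j <;> simp [hi, hj]
  rw [Finset.sum_congr rfl fun ij _ => hterm ij, Finset.sum_ite_eq]
  simp only [Finset.mem_filter, Finset.mem_univ, true_and]

/-- **The coupling product at a permutation matrix.** At the point of `P_σ`,
`∏_{a<b} (1 + (q - 1) · ∑_{j<i} Z_{(a,i)} Z_{(b,j)}) = q^{inv σ}`, `inv σ` the number of pairs `a < b`
with `σ b < σ a`. [folklore] -/
theorem aeval_point_gadget (σ : Perm (Fin n)) (u : τ) :
    aeval (Sum.elim X fun q => if permGraph σ (finProdFinEquiv.symm q) then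
        (1 : MvPolynomial τ K) else 0)
      (∏ ab ∈ Finset.univ.filter (fun ab : Fin n × Fin n => ab.1 < ab.2),
        (1 + ((X (Sum.inl u) : MvPolynomial (τ ⊕ Fin (n * n)) K) - 1) *
          ∑ ij ∈ Finset.univ.filter (fun ij : Fin n × Fin n => ij.2 < ij.1),
            X (Sum.inr (finProdFinEquiv (ab.1, ij.1))) * X (Sum.inr (finProdFinEquiv (ab.2, ij.2)))) :
        MvPolynomial (τ ⊕ Fin (n * n)) K) =
      X u ^ (Finset.univ.filter (fun p : Fin n × Fin n => p.1 < p.2 ∧ σ p.2 < σ p.1)).card := by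
  rw [map_prod]
  have hfac : ∀ ab : Fin n × Fin n,
      aeval (Sum.elim X fun q => if permGraph σ (finProdFinEquiv.symm q) then
          (1 : MvPolynomial τ K) else 0)
        ((1 + ((X (Sum.inl u) : MvPolynomial (τ ⊕ Fin (n * n)) K) - 1) *
          ∑ ij ∈ Finset.univ.filter (fun ij : Fin n × Fin n => ij.2 < ij.1),
            X (Sum.inr (finProdFinEquiv (ab.1, ij.1))) * X (Sum.inr (finProdFinEquiv (ab.2, ij.2)))) :
          MvPolynomial (τ ⊕ Fin (n * n)) K) =
      if σ ab.2 < σ ab.1 then X u else 1 := by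
    intro ab
    rw [map_add, map_one, map_mul, aeval_point_indicator, map_sub, aeval_point_X_inl, map_one]
    split_ifs <;> ring
  rw [Finset.prod_congr rfl fun ab _ => hfac ab, ← Finset.prod_filter, Finset.filter_filter,
    Finset.prod_const]

/-- At the point of `P_σ`, the cover product is the monomial `∏_t X_{σ t, t}`. [folklore] -/
theorem aeval_point_cover (σ : Perm (Fin n)) (x : Fin n × Fin n → τ) :
    aeval (Sum.elim X fun q => if permGraph σ (finProdFinEquiv.symm q) then
        (1 : MvPolynomial τ K) else 0)
      (∏ t : Fin n, ∑ i : Fin n, X (Sum.inr (finProdFinEquiv (t, i))) * X (Sum.inl (x (i, t))) :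
        MvPolynomial (τ ⊕ Fin (n * n)) K) = ∏ t : Fin n, X (x (σ t, t)) := by
  simp only [map_prod, map_sum, map_mul, aeval_point_X_inr, aeval_point_X_inl]
  refine Finset.prod_congr rfl fun t _ => ?_
  rw [Finset.sum_eq_single (σ t)]
  · simp [permGraph]
  · intro i _ hi
    simp [permGraph, Ne.symm hi]
  · simp

end Points

end Summit.ValiantsHypothesis.ValiantsHypothesis.Theorems.AnyonJets.UniformJet

end
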